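import Mathlib
import Summits.NavierStokesRegularity.NavierStokesRegularity.Theorems.FilamentSkeletonRssStadiumDeviationPackage

/-!
# The complexification of the stub's `u X (X j t)` is the prefactor-weighted sum of the complexified summands (`TangentSkeletonNearStraightL`,
# stmt-NavierStokesRegularity-23320, registered stub `stub_stripPropagation` — glue for blueprint item R7′ of `DIAG-addendum2-landed-g2.md`)

`cplx v = (⟪v, eᵢ⟫)ᵢ = (vᵢ : ℂ)ᵢ` is real-linear: it commutes with `Finset.sum` and with real scalars (`cplx_sum_smul`), so for the stub's definition
`u Z y = ∑ k, (Γγ_k/4π) • ∫σ (real summand k)` one has `cplx (u X (X j t)) = ∑ k, ((Γγ_k/4π : ℝ) : ℂ) • cplx (∫σ real summand k)` (`cplx_u_eq`), where each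
`cplx (∫ …)` is identified by Theorems.StadiumOwnRealTotal (`k = j`) / Theorems.StadiumPartnerReal (`k ≠ j`) with the complexified contour integrals.
HONEST FRAMING: bookkeeping for a HYPOTHETICAL filament skeleton on the NEGATIVE side of a MODEL route; nothing here bears on Navier–Stokes regularity or
blow-up.  `--supports stmt-NavierStokesRegularity-23320`.
-/

set_option linter.dupNamespace false

noncomputable section

namespace Summit.NavierStokesRegularity.NavierStokesRegularity.Theorems.StadiumCplxSum

open scoped InnerProductSpace
open Summit.NavierStokesRegularity.NavierStokesRegularity.Theorems.StadiumDeviationPackage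

/-- `cplx` commutes with finite sums and real scalars. [folklore] -/
theorem cplx_sum_smul {ι : Type*} (s : Finset ι) (a : ι → ℝ) (v : ι → EuclideanSpace ℝ (Fin 3)) :
    (fun i => ((⟪∑ k ∈ s, a k • v k, EuclideanSpace.single i (1:ℝ)⟫_ℝ : ℝ) : ℂ)) =
      ∑ k ∈ s, ((a k : ℝ) : ℂ) • (fun i => ((⟪v k, EuclideanSpace.single i (1:ℝ)⟫_ℝ : ℝ) : ℂ)) := by
  funext i
  simp only [inner_single_eq, Finset.sum_apply, Pi.smul_apply, smul_eq_mul]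
  rw [show (∑ k ∈ s, a k • v k) i = ∑ k ∈ s, a k * v k i by simp [Finset.sum_apply]]
  push_cast
  rfl

/-- **The complexified `u X (X j t)`.**  With the stub's defining equation for `u`:
`cplx (u X (X j t)) = ∑ k, (Γγ_k/4π : ℂ) • cplx (∫σ real summand k)`. [folklore] -/
theorem cplx_u_eq {N : ℕ} {Γ : ℝ} {γ : Fin N → ℝ} {X : Fin N → ℝ → EuclideanSpace ℝ (Fin 3)} {Aa : Fin N → ℝ → ℝ}
    {u : (Fin N → ℝ → EuclideanSpace ℝ (Fin 3)) → EuclideanSpace ℝ (Fin 3) → EuclideanSpace ℝ (Fin 3)}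
    (hu : ∀ Z y, u Z y = ∑ k, (Γ * γ k / (4 * Real.pi)) • ∫ σ : ℝ,
      ((‖y - Z k σ‖ ^ 2 + Real.exp (-(1 + Real.eulerMascheroniConstant - Real.log 2)) * Aa k σ) ^ (3/2 : ℝ))⁻¹ •
        Literature.Analysis.FluidPDE.cross (deriv (Z k) σ) (y - Z k σ))
    (j : Fin N) (t : ℝ) :
    (fun i => ((⟪u X (X j t), EuclideanSpace.single i (1:ℝ)⟫_ℝ : ℝ) : ℂ)) =
      ∑ k, (((Γ * γ k / (4 * Real.pi) : ℝ)) : ℂ) • (fun i => ((⟪∫ σ : ℝ,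
        ((‖X j t - X k σ‖ ^ 2 + Real.exp (-(1 + Real.eulerMascheroniConstant - Real.log 2)) * Aa k σ) ^ (3/2 : ℝ))⁻¹ •
          Literature.Analysis.FluidPDE.cross (deriv (X k) σ) (X j t - X k σ), EuclideanSpace.single i (1:ℝ)⟫_ℝ : ℝ) : ℂ)) := by
  rw [hu]
  exact cplx_sum_smul Finset.univ _ _

end Summit.NavierStokesRegularity.NavierStokesRegularity.Theorems.StadiumCplxSum

end
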